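import Mathlib

/-!
# Rigidity of alternating prefix sums that are periodic off one residue class

Helper for the crux stmt-ValiantsHypothesis-7391 (negative lane; `Cruxes/PeelingLemma/DETERMINISTIC-ALLX.md`
§3g STEP 3, the heart of the gadget local lemma [E] for the block gadget).  Pure facts about integer
sequences, no windows: `d : ℕ → ℤ` is the antisymmetric edge content of one arm (finitely supported,
small total mass), `g t = d t - d (t-1)` its vertex charges, `P s = Σ_{t=1}^{s} (-1)^t g t` the
alternating prefix sums (read by the letters of the branch vertex `b`).  If the private readings of the
arm vanish off one residue class `v (mod 2q+1)` — i.e. `P (s + 2q + 1) = P s` whenever `s % (2q+1) ≠ v` —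
and no nonzero value of `d` persists for `2q` consecutive positions (cost `< 2q`), then `P` vanishes
off the class on `[0, 2q]` and `d` has the rigid shape of §3g: Case A (`1 ≤ v`): `d = δ` on `[0, v)`,
`d v = δ/2`-type value, `0` beyond, with `d 0 = -2 (-1)^v P v` (`rigid_caseA`); Case B (`v = 0`):
`P s = d 0` on `[1, 2q]` (`rigid_caseB`).  All hypotheses are stated pointwise (no `Finset` sums), so the
file is `omega`/`ring`-level arithmetic.  No Theses import.
-/

namespace Summit.ValiantsHypothesis.ValiantsHypothesis.Theorems.PeelingLemmaRigidity

-- summit = sub-problem name (single-conjunct summit, D-0017 layout), so the namespace repeats it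
set_option linter.dupNamespace false

/-- Iterating the off-class periodicity: `P (s + k (2q+1)) = P s` for `s` off the class `v`. -/
theorem periodic_iter {q v : ℕ} (P : ℕ → ℤ)
    (hper : ∀ s, s % (2 * q + 1) ≠ v → P (s + (2 * q + 1)) = P s) (s : ℕ) (hs : s % (2 * q + 1) ≠ v)
    (k : ℕ) : P (s + k * (2 * q + 1)) = P s := by
  induction k with
  | zero => simp
  | succ k ih =>
    have hs' : (s + k * (2 * q + 1)) % (2 * q + 1) ≠ v := by
      rw [Nat.add_mul_mod_self_right]; exact hs
    have := hper _ hs'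
    rw [show s + (k + 1) * (2 * q + 1) = s + k * (2 * q + 1) + (2 * q + 1) by ring, this, ih]

/-- If `P` is constant from `M` on and periodic off the class `v`, then off the class `P` equals that
constant everywhere. -/
theorem eq_const_of_offclass {q v M : ℕ} (P : ℕ → ℤ) (c : ℤ) (hM : ∀ s, M ≤ s → P s = c)
    (hper : ∀ s, s % (2 * q + 1) ≠ v → P (s + (2 * q + 1)) = P s) (s : ℕ) (hs : s % (2 * q + 1) ≠ v) :
    P s = c := by
  have h := periodic_iter P hper s hs M
  rw [← h]
  exact hM _ (le_trans (Nat.le_mul_of_pos_right M (by omega)) (Nat.le_add_left _ _))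

/-- From the prefix-sum recursion: `g t = (-1)^t (P t - P (t-1))` for `t ≥ 1`. -/
theorem g_eq {P g : ℕ → ℤ} (hPg : ∀ t, 1 ≤ t → P t - P (t - 1) = (-1) ^ t * g t) (t : ℕ) (ht : 1 ≤ t) :
    g t = (-1) ^ t * (P t - P (t - 1)) := by
  have h := hPg t ht
  have h1 : ((-1 : ℤ) ^ t) * (-1) ^ t = 1 := by
    rw [← pow_add, ← two_mul]; exact Even.neg_one_pow (even_two_mul t)
  calc g t = ((-1 : ℤ) ^ t * (-1) ^ t) * g t := by rw [h1, one_mul]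
    _ = (-1) ^ t * ((-1) ^ t * g t) := by ring
    _ = (-1) ^ t * (P t - P (t - 1)) := by rw [← h]

/-- If `P t = P (t-1)` then `g t = 0` (for `t ≥ 1`). -/
theorem g_eq_zero_of_P_eq {P g : ℕ → ℤ} (hPg : ∀ t, 1 ≤ t → P t - P (t - 1) = (-1) ^ t * g t) (t : ℕ)
    (ht : 1 ≤ t) (h : P t = P (t - 1)) : g t = 0 := by
  rw [g_eq hPg t ht, h, sub_self, mul_zero]

/-- `d` is constant on a stretch where `g` vanishes: if `g t = 0` for `a < t ≤ b` then `d b = d a`. -/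
theorem d_const_of_g_zero {d g : ℕ → ℤ} (hdg : ∀ t, 1 ≤ t → d t - d (t - 1) = g t) {a b : ℕ}
    (hab : a ≤ b) (hz : ∀ t, a < t → t ≤ b → g t = 0) : d b = d a := by
  induction b, hab using Nat.le_induction with
  | base => rfl
  | succ b hb ih =>
    have h1 := hdg (b + 1) (by omega)
    rw [hz (b + 1) (by omega) le_rfl, Nat.add_sub_cancel] at h1
    have := ih (fun t h1 h2 => hz t h1 (by omega))
    linarith

/-- The common core: off the class `v`, `P` is the eventual constant `c`, and `g` vanishes at every
`t ≥ 1` such that both `t` and `t-1` are off the class. -/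
theorem offclass_structure {q v M : ℕ} (P g : ℕ → ℤ) (c : ℤ) (hM : ∀ s, M ≤ s → P s = c)
    (hper : ∀ s, s % (2 * q + 1) ≠ v → P (s + (2 * q + 1)) = P s)
    (hPg : ∀ t, 1 ≤ t → P t - P (t - 1) = (-1) ^ t * g t) (t : ℕ) (ht : 1 ≤ t)
    (h1 : t % (2 * q + 1) ≠ v) (h2 : (t - 1) % (2 * q + 1) ≠ v) : g t = 0 :=
  g_eq_zero_of_P_eq hPg t ht (by
    rw [eq_const_of_offclass P c hM hper t h1, eq_const_of_offclass P c hM hper (t - 1) h2])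

/-- **Case B (`v = 0`: the exceptional letter is the arm's oldest).**  If no nonzero value of `d`
persists through the `2q` positions `1, …, 2q`, then `P s = d 0` for `1 ≤ s ≤ 2q` (and the eventual
constant of `P` is `d 0`). -/
theorem rigid_caseB {q M : ℕ} (hq : 1 ≤ q) (P g d : ℕ → ℤ) (c : ℤ) (hP0 : P 0 = 0)
    (hM : ∀ s, M ≤ s → P s = c)
    (hper : ∀ s, s % (2 * q + 1) ≠ 0 → P (s + (2 * q + 1)) = P s)
    (hPg : ∀ t, 1 ≤ t → P t - P (t - 1) = (-1) ^ t * g t)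
    (hdg : ∀ t, 1 ≤ t → d t - d (t - 1) = g t)
    (hflat : (∀ t, 1 ≤ t → t ≤ 2 * q → d t = d 1) → d 1 = 0) :
    c = d 0 ∧ ∀ s, 1 ≤ s → s ≤ 2 * q → P s = d 0 := by
  -- off-class = not ≡ 0; every s ∈ [1, 2q] is off-class
  have hoff : ∀ s, 1 ≤ s → s ≤ 2 * q → s % (2 * q + 1) ≠ 0 := by
    intro s h1 h2; rw [Nat.mod_eq_of_lt (by omega)]; omega
  have hPs : ∀ s, 1 ≤ s → s ≤ 2 * q → P s = c := fun s h1 h2 =>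
    eq_const_of_offclass P c hM hper s (hoff s h1 h2)
  -- g vanishes on [2, 2q]
  have hg0 : ∀ t, 2 ≤ t → t ≤ 2 * q → g t = 0 := by
    intro t h1 h2
    exact g_eq_zero_of_P_eq hPg t (by omega) (by rw [hPs t (by omega) h2, hPs (t - 1) (by omega) (by omega)])
  -- so d is constant on [1, 2q], hence d 1 = 0
  have hd1 : d 1 = 0 := hflat fun t h1 h2 =>
    d_const_of_g_zero hdg h1 fun t' h1' h2' => hg0 t' (by omega) (by omega)
  -- g 1 = -(P 1 - P 0) = -c and d 1 - d 0 = g 1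
  have hg1 : g 1 = -c := by
    rw [g_eq hPg 1 le_rfl, pow_one, Nat.sub_self, hP0, hPs 1 le_rfl (by omega), sub_zero, neg_one_mul]
  have hd := hdg 1 le_rfl
  rw [Nat.sub_self, hd1, hg1] at hd
  have hc : c = d 0 := by linarith
  exact ⟨hc, fun s h1 h2 => by rw [hPs s h1 h2, hc]⟩

/-- **Case A (`1 ≤ v ≤ 2q`).**  Off the class `P` vanishes (its eventual constant is `P 0 = 0`), the
vertex charges form the equal pair `g v = g (v+1) = (-1)^v P v` below `2q+1` and vanish otherwise there,
`d` equals `d 0` on `[0, v)`, and if no nonzero value of `d` persists through the `2q` positions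
`v+1, …, v+2q` then `d 0 = -2 (-1)^v P v`, `d v = -(-1)^v P v` and `d (v+1) = 0`. -/
theorem rigid_caseA {q v M : ℕ} (hv1 : 1 ≤ v) (hv2 : v ≤ 2 * q) (P g d : ℕ → ℤ) (c : ℤ) (hP0 : P 0 = 0)
    (hM : ∀ s, M ≤ s → P s = c)
    (hper : ∀ s, s % (2 * q + 1) ≠ v → P (s + (2 * q + 1)) = P s)
    (hPg : ∀ t, 1 ≤ t → P t - P (t - 1) = (-1) ^ t * g t)
    (hdg : ∀ t, 1 ≤ t → d t - d (t - 1) = g t)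
    (hflat : (∀ t, v + 1 ≤ t → t ≤ v + 2 * q → d t = d (v + 1)) → d (v + 1) = 0) :
    c = 0 ∧ (∀ s, s ≤ 2 * q → s ≠ v → P s = 0) ∧ (∀ t, t < v → d t = d 0) ∧
      d 0 = -2 * (-1) ^ v * P v ∧ d v = -((-1) ^ v * P v) ∧ d (v + 1) = 0 := by
  have hmod : ∀ s, s ≤ 2 * q → s % (2 * q + 1) = s := fun s hs => Nat.mod_eq_of_lt (by omega)
  -- class of 0 is off: c = P 0 = 0
  have hc : c = 0 := by
    have := eq_const_of_offclass P c hM hper 0 (by rw [hmod 0 (by omega)]; omega)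
    rw [← this, hP0]
  have hoff : ∀ s, s ≤ 2 * q → s ≠ v → P s = 0 := by
    intro s h1 h2
    have := eq_const_of_offclass P c hM hper s (by rw [hmod s h1]; exact h2)
    rw [this, hc]
  -- also P (v + 1 + k) pattern: positions in (v, v + 2q] are off-class
  have hoff' : ∀ s, v < s → s ≤ v + 2 * q → P s = 0 := by
    intro s h1 h2
    have hsm : s % (2 * q + 1) ≠ v := by
      by_cases hs : s < 2 * q + 1
      · rw [Nat.mod_eq_of_lt hs]; omega
      · rw [show s = (s - (2 * q + 1)) + (2 * q + 1) by omega, Nat.add_mod_right,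
          Nat.mod_eq_of_lt (by omega)]
        omega
    rw [eq_const_of_offclass P c hM hper s hsm, hc]
  -- g vanishes on [1, v-1] and on [v+2, v+2q]
  have hgz1 : ∀ t, 1 ≤ t → t < v → g t = 0 := fun t h1 h2 =>
    g_eq_zero_of_P_eq hPg t h1 (by rw [hoff t (by omega) (by omega), hoff (t - 1) (by omega) (by omega)])
  have hgz2 : ∀ t, v + 2 ≤ t → t ≤ v + 2 * q → g t = 0 := fun t h1 h2 =>
    g_eq_zero_of_P_eq hPg t (by omega) (by rw [hoff' t (by omega) h2, hoff' (t - 1) (by omega) (by omega)])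
  -- the pair
  have hgv : g v = (-1) ^ v * P v := by
    rw [g_eq hPg v hv1, hoff (v - 1) (by omega) (by omega), sub_zero]
  have hgv1 : g (v + 1) = (-1) ^ v * P v := by
    rw [g_eq hPg (v + 1) (by omega), Nat.add_sub_cancel, hoff' (v + 1) (by omega) (by omega), zero_sub,
      pow_succ]
    ring
  -- d below v
  have hdlow : ∀ t, t < v → d t = d 0 := fun t ht =>
    d_const_of_g_zero hdg (Nat.zero_le t) fun t' h1 h2 => hgz1 t' (by omega) (by omega)
  -- d v and d (v+1)
  have hdv : d v = d 0 + (-1) ^ v * P v := by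
    have h := hdg v hv1
    rw [hgv, hdlow (v - 1) (by omega)] at h
    linarith
  have hdv1 : d (v + 1) = d 0 + 2 * ((-1) ^ v * P v) := by
    have h := hdg (v + 1) (by omega)
    rw [hgv1, Nat.add_sub_cancel, hdv] at h
    linarith
  -- flatness on [v+1, v+2q] ⇒ d (v+1) = 0
  have hflat' : d (v + 1) = 0 := hflat fun t h1 h2 =>
    d_const_of_g_zero hdg h1 fun t' h1' h2' => hgz2 t' (by omega) (by omega)
  refine ⟨hc, hoff, hdlow, by linarith, by rw [hdv]; linarith, hflat'⟩

/-- The cost form of "no nonzero value persists": if `Σ_{t ∈ [a, a+2q)} |d t| < 2q` (in the pointwise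
form `∀` partial sums… we state it with a `Finset` sum) and `d` is constant on `[a, a+2q)`, then that
constant is `0`. -/
theorem flat_zero_of_small_mass {q a : ℕ} (d : ℕ → ℤ)
    (hmass : ∑ t ∈ Finset.Ico a (a + 2 * q), |d t| < 2 * q)
    (hconst : ∀ t, a ≤ t → t < a + 2 * q → d t = d a) : d a = 0 := by
  by_contra hne
  have h1 : (1 : ℤ) ≤ |d a| := Int.one_le_abs hne
  have : (2 * q : ℤ) ≤ ∑ t ∈ Finset.Ico a (a + 2 * q), |d t| := by
    calc (2 * q : ℤ) = ∑ _t ∈ Finset.Ico a (a + 2 * q), (1 : ℤ) := by simp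
      _ ≤ ∑ t ∈ Finset.Ico a (a + 2 * q), |d t| := Finset.sum_le_sum fun t ht => by
          rw [Finset.mem_Ico] at ht
          rw [hconst t ht.1 ht.2]; exact h1
  linarith

end Summit.ValiantsHypothesis.ValiantsHypothesis.Theorems.PeelingLemmaRigidity
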